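import Summits.AtomisticToContinuum.FouriersLaw.Theorems.OddSectorIrreversibilityConeScaleCorrectorStubCorrectorWitnessBoundOfCruxes

/-!
# `ConeScaleCorrector` (E1) from the memory-time bound (M) and the sibling cruxes `P`, `E2` — the glue of line Sketch, in the tree

Support file for crux stmt-AtomisticToContinuum-14069 (`OddSectorIrreversibility.ConeScaleCorrector`, E1), line
`Sketch` (card `memory-time-bootstrap`). With the witness jaw (W′) landed conditionally on the two existing sibling
cruxes (`stub_correctorWitnessBound_of_cruxes : TapLeakBound → SubBallisticWindow → (W′)`,
`…StubCorrectorWitnessBoundOfCruxes.lean`), the line's kernel-checked composition reads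

  `coneScaleCorrector_of_memoryTimeBound_of_cruxes : (M) → TapLeakBound → SubBallisticWindow → ConeScaleCorrector`,

where (M) is the registered stub `stub_memoryTimeBound` VERBATIM (the memory-time / one-vector contact-Poincaré
bound `∫u² dμ_T ≤ A·N·∫u·J_tot dμ_T + B·N²·Z` for every a.e.-limit corrector, `A ≥ 0`, `A, B` independent of `N`)
and the conclusion is the route decl BY NAME. The glue is the card's bootstrap (`x² ≤ a·x + b ⇒ x² ≤ a² + 2b`,
`C = A²K₁² + 2(|AK₂| + |B|)`); no `N`-uniform input hides in it. This is the tree-side form of the typed split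
D6 of `Cruxes/ConeScaleCorrector/STRATEGY-CENSUS.md` §4 (E1 ⟸ (M) ∧ P ∧ E2): if the planner promotes (M) to an
item, this theorem is the glue; (M) itself is NOT proved anywhere (open, supplier-less — the crux's wall).
No definitions; no route statement is asserted unconditionally.
-/

noncomputable section

open MeasureTheory Filter Topology Set
open scoped ENNReal NNReal
open Literature.MathematicalPhysics.KineticTheory.HeatConduction
open Literature.MathematicalPhysics.KineticTheory.OddSectorLocality

namespace Summit.AtomisticToContinuum.FouriersLaw.Theorems.OddSectorIrreversibility

/-- The real-variable core of the bootstrap: `x² ≤ a·x + b` forces `x² ≤ a² + 2b`. [folklore] -/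
theorem sq_le_sq_add_two_mul_of_sq_le {x a b : ℝ} (h : x ^ 2 ≤ a * x + b) : x ^ 2 ≤ a ^ 2 + 2 * b := by
  nlinarith [sq_nonneg (x - a), sq_abs a, sq_nonneg (|x| - |a|), abs_mul_abs_self x, abs_nonneg x,
    abs_nonneg a, le_abs_self (a * x), abs_mul a x]

/-- **E1 from (M), P, E2 (the glue of line Sketch, registered stub (M) as hypothesis).** The memory-time bound
(M) `∫u² ≤ A·N·⟨u,J⟩ + B·N²·Z` and the witness jaw (W′) `⟨u,J⟩ ≤ K₁‖u‖√Z + K₂·N·Z` (landed from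
`TapLeakBound` and `SubBallisticWindow`) give `‖u‖² ≤ A·N(K₁‖u‖√Z + K₂NZ) + BN²Z`, a quadratic inequality in
`‖u‖` whose solution is `‖u‖² ≤ (A²K₁² + 2(|AK₂| + |B|))·N²·Z` — the route decl `ConeScaleCorrector` by name.
[folklore] -/
theorem coneScaleCorrector_of_memoryTimeBound_of_cruxes :
    (∀ ω₂ lam β γ : ℝ, 0 < ω₂ → 0 < lam → 0 < β → 0 < γ → ∀ T : ℝ, 0 < T → ∃ A B : ℝ, 0 ≤ A ∧
      ∀ (N : ℕ) (u : Literature.MathematicalPhysics.KineticTheory.HeatConduction.PhaseSpace N → ℝ),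
      (∀ᵐ x ∂(Literature.MathematicalPhysics.KineticTheory.OddSectorLocality.gibbsWeight ω₂ lam β γ T N),
        Filter.Tendsto (fun τ : ℝ => ∫ t in Set.Ioc (0 : ℝ) τ,
          Literature.MathematicalPhysics.KineticTheory.OddSectorLocality.currentForecast ω₂ lam β γ T N t x)
          Filter.atTop (nhds (u x))) →
      MeasureTheory.MemLp u 2 (Literature.MathematicalPhysics.KineticTheory.OddSectorLocality.gibbsWeight ω₂ lam β γ T N) ∧
      ∫ x, (u x) ^ 2 ∂(Literature.MathematicalPhysics.KineticTheory.OddSectorLocality.gibbsWeight ω₂ lam β γ T N) ≤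
        A * (N : ℝ) * (∫ x, u x * (∑ i : Fin N,
            (Literature.MathematicalPhysics.KineticTheory.HeatConduction.pinnedChain ω₂ lam β γ).bondCurrent N i x)
            ∂(Literature.MathematicalPhysics.KineticTheory.OddSectorLocality.gibbsWeight ω₂ lam β γ T N)) +
        B * (N : ℝ) ^ 2 * ∫ x, Real.exp
            (-((Literature.MathematicalPhysics.KineticTheory.HeatConduction.pinnedChain ω₂ lam β γ).hamiltonian N x) / T)
            ∂MeasureTheory.volume) →
    Summit.AtomisticToContinuum.FouriersLaw.Theses.OddSectorIrreversibility.TapLeakBound →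
    Summit.AtomisticToContinuum.FouriersLaw.Theses.OddSectorIrreversibility.SubBallisticWindow →
    Summit.AtomisticToContinuum.FouriersLaw.Theses.OddSectorIrreversibility.ConeScaleCorrector := by
  intro hM hP hE2
  have hW := stub_correctorWitnessBound_of_cruxes hP hE2
  intro ω₂ lam β γ hω hl hβ hγ T hT
  obtain ⟨A, B, hA, hM'⟩ := hM ω₂ lam β γ hω hl hβ hγ T hT
  obtain ⟨K₁, K₂, hW'⟩ := hW ω₂ lam β γ hω hl hβ hγ T hT
  refine ⟨A ^ 2 * K₁ ^ 2 + 2 * (|A * K₂| + |B|), fun N u => ?_⟩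
  dsimp only
  intro hu
  obtain ⟨hmem, hineq⟩ := hM' N u hu
  have hw := hW' N u hu hmem
  refine ⟨hmem, ?_⟩
  set I := ∫ x, (u x) ^ 2 ∂(gibbsWeight ω₂ lam β γ T N) with hI
  set G := ∫ x, u x * (∑ i : Fin N, (pinnedChain ω₂ lam β γ).bondCurrent N i x) ∂(gibbsWeight ω₂ lam β γ T N) with hG
  set z := ∫ x, Real.exp (-((pinnedChain ω₂ lam β γ).hamiltonian N x) / T) ∂(volume : Measure (PhaseSpace N)) with hz
  change I ≤ (A ^ 2 * K₁ ^ 2 + 2 * (|A * K₂| + |B|)) * (N : ℝ) ^ 2 * z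
  have hz0 : 0 ≤ z := integral_nonneg fun _ => (Real.exp_pos _).le
  have hI0 : 0 ≤ I := integral_nonneg fun _ => sq_nonneg _
  have hN0 : (0 : ℝ) ≤ N := Nat.cast_nonneg N
  -- x := ‖u‖, with x² = I
  set x := Real.sqrt I with hx
  have hxI : x ^ 2 = I := Real.sq_sqrt hI0
  have hsz : Real.sqrt z ^ 2 = z := Real.sq_sqrt hz0
  -- chain (M) and (W′): I ≤ A N (K₁ x √z + K₂ N z) + B N² z
  have h1 : I ≤ A * N * (K₁ * x * Real.sqrt z + K₂ * N * z) + B * (N : ℝ) ^ 2 * z := by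
    have hAN : 0 ≤ A * N := mul_nonneg hA hN0
    have := mul_le_mul_of_nonneg_left hw hAN
    linarith
  -- take absolute values of the constants
  have h2 : I ≤ (A * N * K₁ * Real.sqrt z) * x + (|A * K₂| + |B|) * (N : ℝ) ^ 2 * z := by
    have e1 : A * N * (K₁ * x * Real.sqrt z + K₂ * N * z) =
        (A * N * K₁ * Real.sqrt z) * x + (A * K₂) * (N : ℝ) ^ 2 * z := by
      ring
    rw [e1] at h1
    have h3 : (A * K₂) * (N : ℝ) ^ 2 * z ≤ |A * K₂| * (N : ℝ) ^ 2 * z := by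
      apply mul_le_mul_of_nonneg_right _ hz0
      exact mul_le_mul_of_nonneg_right (le_abs_self _) (by positivity)
    have h4 : B * (N : ℝ) ^ 2 * z ≤ |B| * (N : ℝ) ^ 2 * z := by
      apply mul_le_mul_of_nonneg_right _ hz0
      exact mul_le_mul_of_nonneg_right (le_abs_self _) (by positivity)
    nlinarith
  -- quadratic inequality in x
  rw [← hxI] at h2
  have h5 := sq_le_sq_add_two_mul_of_sq_le h2
  rw [hxI] at h5
  have e2 : (A * N * K₁ * Real.sqrt z) ^ 2 = A ^ 2 * K₁ ^ 2 * (N : ℝ) ^ 2 * z := by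
    rw [show (A * N * K₁ * Real.sqrt z) ^ 2 = A ^ 2 * K₁ ^ 2 * (N : ℝ) ^ 2 * Real.sqrt z ^ 2 by ring, hsz]
  rw [e2] at h5
  have e3 : A ^ 2 * K₁ ^ 2 * (N : ℝ) ^ 2 * z + 2 * ((|A * K₂| + |B|) * (N : ℝ) ^ 2 * z) =
      (A ^ 2 * K₁ ^ 2 + 2 * (|A * K₂| + |B|)) * (N : ℝ) ^ 2 * z := by ring
  linarith [e3]

end Summit.AtomisticToContinuum.FouriersLaw.Theorems.OddSectorIrreversibility

end
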